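/-
Origin: expansion seat `prover-pub-hodgecm-mc-sinst-1-g10-0`, handover #1247 2026-08-20T22:36Z md5 85197c825c7f (410 l.; NEW additive leaf, ns HodgeCM.Level (capThree, capThree_K, capThree_le_three, capThree_K_le, belowConjThree_capThree) / HodgeCM.Model.ThetaAdelicSide.ThetaDistDatum: satG (abbrev), kappaK, tauK, sigmaK, tauK_dual_apply, sat_fix, famsK, act_fam_K, isThetaEquivariant_fam_K, mem_famsK, sitOf, sitOf_isSaturated, sitOf_isStrict, coe_thetaForm_sitOf, dist_mem_adelicThetaSpanSat, finSlotT, continuous_finSlotT, thetaArchCLMFin, apply_dist_mul_ιinf, isHolGerm_dist, dist_mem_holSat, exists_tlvl_fix, dist_mem_holSatU, distU/coe_distU, distU_ωf_V, distU_ωf_W; imports #1246 + #1243 + Model/ThetaHolContinuity; NAMES for audit: HodgeCM.Model.ThetaAdelicSide.ThetaDistDatum.dist_mem_adelicThetaSpanSat · HodgeCM.Model.ThetaAdelicSide.ThetaDistDatum.isHolGerm_dist · HodgeCM.Model.ThetaAdelicSide.ThetaDistDatum.distU_ωf_V) (`HOME/mc/pub-hodgecm-mc-sinst-1-g10/stage65/HodgeCM/Model/AdelicThetaDistributionSat.lean`,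 md5 85197c825c7f, 410 lines);
landed by the gen-27 packager (p-g27) in gate run 65 as `HodgeCM/Model/AdelicThetaDistributionSat.lean` (verbatim).
-/
/-
Copyright (c) 2026 the pub-hodgecm formalisation cell (harness21).  New file, not vendored.
Origin: session prover-pub-hodgecm-mc-sinst-1-g10-0 (unit pub-hodgecm-mc-sinst-1-g10, S-INSTANCE CONSTRUCTOR gen 10; the (J4) input of the
(J-Liu-Θ) junction behind E's row 9 `hΘ`: the theta distribution lands in the saturated hol-germ theta module `holSatU`), 2026-08-20.
Intended final place: `HodgeCM/Model/AdelicThetaDistributionSat.lean` (NEW additive model-layer leaf; imports sinst-1's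
`HodgeCM.Model.AdelicThetaDistribution` and `HodgeCM.Model.AdelicThetaTowerLift` (#1243), autform/theta-3's `HodgeCM.Model.ThetaHolContinuity`;
nothing imports it; drop alone).
-/
import Summits.HodgeConjecture.HodgeCM.Model.AdelicThetaDistribution
import Summits.HodgeConjecture.HodgeCM.Model.AdelicThetaTowerLift
import Summits.HodgeConjecture.HodgeCM.Model.ThetaHolContinuity

set_option autoImplicit false

/-!
# The theta distribution lands in the saturated hol-germ theta module

For a product Weil datum `D : S.ThetaDistDatum hV k` (`Model/AdelicThetaDistribution`):
* § 1 `D.sitOf K hK` — the STRICT `K`-type situation (level `⊥`) of the product families `Φarch(·) ⊗ Φ_f`, `Φ_f` fixed by the finite level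
  `K ≤ U(V)(𝔸_f)`, with finite `K`-type the saturation group `satLevelRegimeOf V hV K = Π_{w ≠ w(ι₁)} U(V)(L⁺_w) × K` (carch's (C-Kf∞)
  design; `hK : satLevelRegimeOf V hV K ≤ S.Gfin`, carch's `hK`, = `satLevelRegimeOf_le_archFinOf` at the honest `S`); SATURATED at
  `satLevelRegimeOf V hV K` (`sitOf_isSaturated`), STRICT (`sitOf_isStrict`: `hA`/`harm` on `Stab(x₀)`, `hdef` + `fin_V` on the saturation group,
  split as in carch's `ArchKTypeOfFix`);
* § 2 **`dist_mem_adelicThetaSpanSat`**: `D.dist f Φ_f ∈ adelicThetaSpanSat (S.P k) S.ιinf _ (weightOf x₀) (satLevelRegimeOf V hV K) 𝓕` for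
  `f ∈ 𝓕` and `Φ_f` fixed by `K` (#1238 `coe_mem_adelicThetaSpanSat`);
* § 3 **`isHolGerm_dist`**: `IsHolGerm S.ιinf (D.dist f Φ_f)` from (LF) `(S.P k).IsLFAction` (continuity of the archimedean theta functionals at
  EVERY finite vector, tree `continuous_toThetaTop_repWeilThetaDatum_tmul`), (AN) weak differentiability and (REP′) the Cauchy–Riemann shape of
  the boosts `b ↦ ωA (expP b) (Φarch ℓ)` — E's binders `hLF`/`hpd`/`hk` in carch's `archKTypeOf` currency (`isWeaklyPDiff_archKTypeOf` /
  `ThetaHolAssembly.isWeaklyCR_of_isPMinusKilled`);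
* § 4 **`D.distU … : 𝒮((𝔸_{L⁺}^∞)³) →ₗ[ℂ] S.holSatU hV k 𝓕`** — the distribution as a linear map INTO the saturated hol-germ theta module of the
  slot (all levels; the level carrying `Φ_f` comes from `smooth`, cut down below `K_f(3)`: `Level.capThree`), with
  **`distU_ωf_V`** (`distU (ωf (k_f,1) Φ_f) = holSatRep k_f (distU Φ_f)` — the `hσ` of #1244 `clsU_mem_iSup_range_of_equivariant`) and
  **`distU_ωf_W`** (`distU (ωf (1,u) Φ_f) = chiFin χ u • distU Φ_f` at `f = charInv χ` — the `hf` of theta-3's `TwistedCoinv.lift`).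
KERNEL only: 0 records, 0 `def … : Prop`, nothing cited as a sentence; `#print axioms` ⊆ {propext, Classical.choice, Quot.sound}.
-/

noncomputable section

open MeasureTheory MulAction IsDedekindDomain NumberField.mixedEmbedding Filter Topology
open NumberField hiding relNormOneIdeles relNormOneRat probHaarRelNormOneQuot
open Literature.NumberTheory.Automorphic Literature.NumberTheory.Weil1964
open Literature.NumberTheory.Automorphic.UnitaryGroup
open Literature.NumberTheory.Automorphic.WeightForms (IsLevelCorrected IsWeightMatched)
open Literature.Geometry.ComplexHyperbolic.BallModel (U21 x₀)
open Literature.AlgebraicGeometry.HodgeTheory Literature.AlgebraicGeometry.ShimuraVarieties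
open Literature.NumberTheory.Automorphic.PicardCM
open HodgeCM.Model.SupplyInstance HodgeCM.Model.SupplyResidual HodgeCM.Model.ThetaSpace HodgeCM.Model.TowerCarrier
open HodgeCM.Model.SupplyResidual.WeilPairData (charInv)
open scoped SchwartzMap TensorProduct Classical

namespace HodgeCM

/-! ### § 0. Cutting a level below `K_f(3)` inside an open subgroup -/

namespace Level

variable {L : CMField} {ι₁ : L →+* ℂ} {V : HermSpace3 L ι₁}

/-- The level `(U(L⁺) ∩ (K_f(3) ∩ K₀), K_f(3) ∩ K₀)` for an OPEN subgroup `K₀ ≤ U(V)(𝔸_f)`: compact open, torsion-free (below `Γ(3)`). -/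
def capThree (K₀ : Subgroup ↥V.adelicFin) (hK₀ : IsOpen (K₀ : Set ↥V.adelicFin)) : Level V where
  Γ := UnitaryGroup.arithmeticLevel (↥(maximalRealSubfield L)) L (IsCMField.complexConj L) 3 V.Hm ((Level.three V).K ⊓ K₀)
  K := (Level.three V).K ⊓ K₀
  isCompact_K := by
    rw [Subgroup.coe_inf]
    exact (Level.three V).isCompact_K.inter_right (Subgroup.isClosed_of_isOpen _ hK₀)
  isOpen_K := by
    rw [Subgroup.coe_inf]
    exact (Level.three V).isOpen_K.inter hK₀
  arithmeticLevel_K := rfl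
  torsionFree γ hγ hfin :=
    (Level.three V).torsionFree γ
      ((Level.three V).arithmeticLevel_K ▸ UnitaryGroup.arithmeticLevel_mono (inf_le_left : (Level.three V).K ⊓ K₀ ≤ _) hγ) hfin

/-- (Ported verbatim from the HodgeCMPerL package; no docstring in the source.) -/
theorem capThree_K (K₀ : Subgroup ↥V.adelicFin) (hK₀ : IsOpen (K₀ : Set ↥V.adelicFin)) :
    (capThree K₀ hK₀).K = (Level.three V).K ⊓ K₀ := rfl

/-- (Ported verbatim from the HodgeCMPerL package; no docstring in the source.) -/
theorem capThree_le_three (K₀ : Subgroup ↥V.adelicFin) (hK₀ : IsOpen (K₀ : Set ↥V.adelicFin)) :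
    capThree K₀ hK₀ ≤ Level.three V := Level.le_def.mpr inf_le_left

/-- (Ported verbatim from the HodgeCMPerL package; no docstring in the source.) -/
theorem capThree_K_le (K₀ : Subgroup ↥V.adelicFin) (hK₀ : IsOpen (K₀ : Set ↥V.adelicFin)) : (capThree K₀ hK₀).K ≤ K₀ :=
  inf_le_right

/-- (Ported verbatim from the HodgeCMPerL package; no docstring in the source.) -/
theorem belowConjThree_capThree (K₀ : Subgroup ↥V.adelicFin) (hK₀ : IsOpen (K₀ : Set ↥V.adelicFin)) :
    (capThree K₀ hK₀).BelowConjThree :=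
  Level.belowConjThree_of_le_three (capThree_le_three K₀ hK₀)

end Level

namespace Model
namespace ThetaAdelicSide
namespace ThetaDistDatum

variable {L : CMField} {ι₁ : L →+* ℂ} {V : HermSpace3 L ι₁} {c : SeesawCtx L}
variable {S : ThetaAdelicSide V c} {hV : IsAnisotropic L V.Hm} {k : Fin 4} (D : S.ThetaDistDatum hV k)

/-- The saturation group of the finite level `K`, typed as a subgroup of the regime model group `G_U(𝔸)` (typing aid, reducible). -/
abbrev satG (hV : IsAnisotropic L V.Hm) (K : Subgroup ↥V.adelicFin) : Subgroup (V.latticeModel printFact_unitaryCompact_holds).G :=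
  satLevelRegimeOf V hV K

/-! ### § 1. The product `K`-type situation at a finite level -/

section Situation

variable (K : Subgroup ↥V.adelicFin)
  (hK : satG hV K ≤ S.Gfin)

/-- The `K`-type map `(u, m) ↦ S.ιinf u · m` on `Stab(x₀) × satLevelRegimeOf V hV K`. -/
def kappaK : ↥(stabilizer U21 x₀) × ↥(satG hV K) →* (V.latticeModel printFact_unitaryCompact_holds).G :=
  (kappa₀ S).noncommCoprod (satG hV K).subtype fun u m => (S.comm_fin (u : U21) m.1 (hK m.2)).symm

/-- (Ported verbatim from the HodgeCMPerL package; no docstring in the source.) -/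
@[simp] theorem kappaK_apply (u : ↥(stabilizer U21 x₀)) (m : ↥(satG hV K)) :
    kappaK K hK (u, m) = S.ιinf u * (m : (V.latticeModel printFact_unitaryCompact_holds).G) := rfl

/-- The weight `τ₁ ∘ fst` of the situation. -/
def tauK : Representation ℂ (↥(stabilizer U21 x₀) × ↥(satG hV K)) (Fin 2 → ℂ) :=
  (BallForms.isPullbackCocycle_cotangentCocycle.weightOf x₀).comp (MonoidHom.fst _ _)

/-- (Ported verbatim from the HodgeCMPerL package; no docstring in the source.) -/
@[simp] theorem tauK_apply (u : ↥(stabilizer U21 x₀)) (m : ↥(satG hV K)) :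
    tauK (hV := hV) K (u, m) = BallForms.isPullbackCocycle_cotangentCocycle.weightOf x₀ u := rfl

/-- The `K`-type `τ₁^∨ ∘ fst` of the situation on `E := W^∨`. -/
def sigmaK : Representation ℂ (↥(stabilizer U21 x₀) × ↥(satG hV K)) (Module.Dual ℂ (Fin 2 → ℂ)) :=
  (BallForms.isPullbackCocycle_cotangentCocycle.weightOf x₀).dual.comp (MonoidHom.fst _ _)

/-- (Ported verbatim from the HodgeCMPerL package; no docstring in the source.) -/
@[simp] theorem sigmaK_apply (u : ↥(stabilizer U21 x₀)) (m : ↥(satG hV K)) :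
    sigmaK (hV := hV) K (u, m) = (BallForms.isPullbackCocycle_cotangentCocycle.weightOf x₀).dual u := rfl

/-- (Ported verbatim from the HodgeCMPerL package; no docstring in the source.) -/
theorem tauK_dual_apply (x : ↥(stabilizer U21 x₀) × ↥(satG hV K)) (ℓ : Module.Dual ℂ (Fin 2 → ℂ)) :
    (tauK (hV := hV) K).dual x ℓ = sigmaK (hV := hV) K x ℓ := by
  obtain ⟨u, m⟩ := x
  rw [Representation.dual_apply, Prod.inv_mk, tauK_apply, sigmaK_apply, Representation.dual_apply]

/-- **The saturation group fixes `Φarch ℓ ⊗ Φ_f` when `K` fixes `Φ_f`** (split `x = (a_∞, 1)·(1, k_f)` with `a` away from `ι₁`, `k_f ∈ K`: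
`hdef` on the first factor, `fin_V` + the `K`-fixedness on the second — carch's `satLevel_fix_of_arch_of_fin` for general `Φ_f`). -/
theorem sat_fix {Φf : FinSB (↥(maximalRealSubfield L)) (Fin 3)} (hΦ : ∀ g ∈ K, D.ωf (g, 1) Φf = Φf)
    (x : (V.latticeModel printFact_unitaryCompact_holds).G)
    (hx : x ∈ satG hV K) (ℓ : Module.Dual ℂ (Fin 2 → ℂ)) :
    (S.P k).ω (x, 1) (piSchwartzBruhatEquiv (↥(maximalRealSubfield L)) (Fin 3) (D.Φarch ℓ ⊗ₜ[ℂ] Φf)) =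
      piSchwartzBruhatEquiv (↥(maximalRealSubfield L)) (Fin 3) (D.Φarch ℓ ⊗ₜ[ℂ] Φf) := by
  obtain ⟨g, hg, rfl⟩ := hx
  have hg' : g ∈ satLevelOf V K := hg
  obtain ⟨hga, hgf⟩ := Subgroup.mem_inf.1 hg'
  have hsplit := archToAdelic_mul_finAdelicToAdelic (↥(maximalRealSubfield L)) L (IsCMField.complexConj L) 3 V.Hm g
  have ha : UnitaryGroup.archAt (↥(maximalRealSubfield L)) L (IsCMField.complexConj L) 3 V.Hm
      (UnitaryGroup.cmPlace (L : Type) ι₁) (NumberField.complexConj_smul_infinitePlace (L : Type) _)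
      (IsCMField.complexConj_ne_one (L : Type))
      (archPart (↥(maximalRealSubfield L)) L (IsCMField.complexConj L) 3 V.Hm g) = 1 :=
    (mem_awayFrom_iff (↥(maximalRealSubfield L)) L (IsCMField.complexConj L) 3 V.Hm
      (IsCMField.complexConj_ne_one (L : Type)) (NumberField.complexConj_smul_infinitePlace (L : Type))
      (UnitaryGroup.cmPlace (L : Type) ι₁) g).1 hga
  have hf : finPart (↥(maximalRealSubfield L)) L (IsCMField.complexConj L) 3 V.Hm g ∈ K :=
    (mem_cmSplitLevel_iff (L : Type) 3 V.Hm K g).1 hgf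
  have hsplit' : (HodgeCM.Adelic.regimeEquiv L V.Hm hV).toMonoidHom g =
      HodgeCM.Adelic.regimeEquiv L V.Hm hV
          (UnitaryGroup.archToAdelic (↥(maximalRealSubfield L)) L (IsCMField.complexConj L) 3 V.Hm
            (archPart (↥(maximalRealSubfield L)) L (IsCMField.complexConj L) 3 V.Hm g)) *
        HodgeCM.Adelic.regimeEquiv L V.Hm hV
          (UnitaryGroup.finAdelicToAdelic (↥(maximalRealSubfield L)) L (IsCMField.complexConj L) 3 V.Hm
            (finPart (↥(maximalRealSubfield L)) L (IsCMField.complexConj L) 3 V.Hm g)) := by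
    rw [← map_mul]
    exact congrArg (HodgeCM.Adelic.regimeEquiv L V.Hm hV) hsplit.symm
  have hfin : (S.P k).ω (HodgeCM.Adelic.regimeEquiv L V.Hm hV
      (UnitaryGroup.finAdelicToAdelic (↥(maximalRealSubfield L)) L (IsCMField.complexConj L) 3 V.Hm
        (finPart (↥(maximalRealSubfield L)) L (IsCMField.complexConj L) 3 V.Hm g)), 1)
      (piSchwartzBruhatEquiv (↥(maximalRealSubfield L)) (Fin 3) (D.Φarch ℓ ⊗ₜ[ℂ] Φf)) =
      piSchwartzBruhatEquiv (↥(maximalRealSubfield L)) (Fin 3) (D.Φarch ℓ ⊗ₜ[ℂ] Φf) := by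
    rw [← cmAdelicProdEquiv_symm_one, ← finToG_apply, D.fin_V, adelicTensorEnd_apply_tmul, LinearMap.id_apply, hΦ _ hf]
  let ρ' : ↥(HodgeCM.Adelic.regimeSubgroup L V.Hm) →* Module.End ℂ ↥(piSchwartzBruhat (↥(maximalRealSubfield L)) (Fin 3)) :=
    (S.P k).ω.comp (MonoidHom.inl _ _)
  have e1 : ∀ x : ↥(HodgeCM.Adelic.regimeSubgroup L V.Hm), (S.P k).ω (x, 1) = ρ' x := fun _ => rfl
  rw [e1, hsplit', map_mul ρ', Module.End.mul_apply, ← e1, ← e1, hfin, D.hdef _ ha]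

/-- The test families of the situation: the product families of the `K`-fixed `Φ_f`. -/
def famsK : Set {j : Module.Dual ℂ (Fin 2 → ℂ) →ₗ[ℂ] (S.P k).weilDatum.ThetaTop //
    (S.P k).kernelDatum.IsThetaEquivariant (kappaK K hK) (sigmaK K) j} :=
  {j | ∃ Φf : FinSB (↥(maximalRealSubfield L)) (Fin 3), (∀ g ∈ K, D.ωf (g, 1) Φf = Φf) ∧ j.1 = D.fam Φf}

/-- (W-⊗) + (W-K∞′) + `sat_fix` ⇒ the product family of a `K`-fixed `Φ_f` acts ON THE NOSE through the situation's `K`-type. -/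
theorem act_fam_K {Φf : FinSB (↥(maximalRealSubfield L)) (Fin 3)} (hΦ : ∀ g ∈ K, D.ωf (g, 1) Φf = Φf)
    (x : ↥(stabilizer U21 x₀) × ↥(satG hV K)) (ℓ : Module.Dual ℂ (Fin 2 → ℂ)) :
    D.fam Φf (sigmaK K x ℓ) = (S.P k).kernelDatum.W.act ((S.P k).kernelDatum.s (kappaK K hK x, 1)) (D.fam Φf ℓ) := by
  obtain ⟨u, m⟩ := x
  change piSchwartzBruhatEquiv (↥(maximalRealSubfield L)) (Fin 3)
      (D.Φarch ((BallForms.isPullbackCocycle_cotangentCocycle.weightOf x₀).dual u ℓ) ⊗ₜ[ℂ] Φf) =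
    (S.P k).ω (S.ιinf u * (m : (V.latticeModel printFact_unitaryCompact_holds).G), 1)
      (piSchwartzBruhatEquiv (↥(maximalRealSubfield L)) (Fin 3) (D.Φarch ℓ ⊗ₜ[ℂ] Φf))
  have hmul : ((S.ιinf u * (m : (V.latticeModel printFact_unitaryCompact_holds).G), 1) :
      (V.latticeModel printFact_unitaryCompact_holds).G × ↥(relNormOneIdeles (↥(maximalRealSubfield L)) L)) =
      (S.ιinf u, 1) * ((m : (V.latticeModel printFact_unitaryCompact_holds).G), 1) := by
    rw [Prod.mk_mul_mk, mul_one]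
  rw [hmul, map_mul, Module.End.mul_apply, D.sat_fix K hΦ m.1 m.2, D.hA, adelicTensorEnd_apply_tmul, LinearMap.id_apply, D.harm]

/-- (Ported verbatim from the HodgeCMPerL package; no docstring in the source.) -/
theorem isThetaEquivariant_fam_K {Φf : FinSB (↥(maximalRealSubfield L)) (Fin 3)} (hΦ : ∀ g ∈ K, D.ωf (g, 1) Φf = Φf) :
    (S.P k).kernelDatum.IsThetaEquivariant (kappaK K hK) (sigmaK K) (D.fam Φf) :=
  (S.P k).kernelDatum.isThetaEquivariant_of_act fun x ℓ => D.act_fam_K K hK hΦ x ℓ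

/-- (Ported verbatim from the HodgeCMPerL package; no docstring in the source.) -/
theorem mem_famsK {Φf : FinSB (↥(maximalRealSubfield L)) (Fin 3)} (hΦ : ∀ g ∈ K, D.ωf (g, 1) Φf = Φf) :
    (⟨D.fam Φf, D.isThetaEquivariant_fam_K K hK hΦ⟩ : {j : Module.Dual ℂ (Fin 2 → ℂ) →ₗ[ℂ] (S.P k).weilDatum.ThetaTop //
      (S.P k).kernelDatum.IsThetaEquivariant (kappaK K hK) (sigmaK K) j}) ∈ D.famsK K hK :=
  ⟨Φf, hΦ, rfl⟩

/-- **The product `K`-type situation of the datum at the finite level `K`** (level `⊥` on the archimedean side). -/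
def sitOf : KTypeSituation (S.P k) S.ιinf (⊥ : Subgroup U21) (stabilizer U21 x₀).subtype
    (BallForms.isPullbackCocycle_cotangentCocycle.weightOf x₀) where
  Kc := ↥(stabilizer U21 x₀) × ↥(satG hV K)
  κ := kappaK K hK
  E := Module.Dual ℂ (Fin 2 → ℂ)
  σ := sigmaK K
  τ := tauK K
  ι := LinearMap.id
  hι := tauK_dual_apply K
  η₁ := MonoidHom.inl _ _
  hΔ δ hδ := ⟨1, map_one _, by
    rw [(Subgroup.mem_bot).1 hδ, map_one, map_one, one_mul]
    exact (S.P k).ΓU.one_mem, fun x => by rw [map_one]; exact Commute.one_left _⟩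
  hη := ⟨fun u => by rw [MonoidHom.inl_apply, kappaK_apply, OneMemClass.coe_one, mul_one]; rfl, fun _ => rfl⟩
  𝓙 := D.famsK K hK

/-- (Ported verbatim from the HodgeCMPerL package; no docstring in the source.) -/
@[simp] theorem sitOf_𝓙 : (D.sitOf K hK).𝓙 = D.famsK K hK := rfl

/-- The situation is SATURATED at the saturation group of `K`: index `(1, m)`, weight `1`. -/
theorem sitOf_isSaturated :
    (D.sitOf K hK).IsSaturated (satG hV K) :=
  fun g hg => ⟨((1 : ↥(stabilizer U21 x₀)), ⟨g, hg⟩), by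
    change kappaK K hK (1, ⟨g, hg⟩) = g
    rw [kappaK_apply, OneMemClass.coe_one, map_one, one_mul], by
    change tauK K (1, _) = 1
    rw [tauK_apply, map_one]⟩

/-- The situation is STRICT. -/
theorem sitOf_isStrict : (D.sitOf K hK).IsStrict := by
  rintro j ⟨Φf, hΦ, hj⟩ x e
  change j.1 (sigmaK K x e) = (S.P k).kernelDatum.W.act ((S.P k).kernelDatum.s (kappaK K hK x, 1)) (j.1 e)
  rw [hj]
  exact D.act_fam_K K hK hΦ x e

/-! ### § 2. Membership in the saturated adèlic theta module -/

/-- The theta form of the situation at a `K`-fixed `Φ_f` has the same VALUES as `D.dist f Φ_f` (the weight group does not enter them). -/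
theorem coe_thetaForm_sitOf {Φf : FinSB (↥(maximalRealSubfield L)) (Fin 3)} (hΦ : ∀ g ∈ K, D.ωf (g, 1) Φf = Φf)
    (f : C(↥(relNormOneIdeles (↥(maximalRealSubfield L)) L) ⧸ relNormOneRat (↥(maximalRealSubfield L)) L, ℂ)) :
    (((S.P k).kernelDatum.thetaForm (probHaarRelNormOneQuot (↥(maximalRealSubfield L)) L) (S.P k).kernelDatum_thetaLinear
        (D.sitOf K hK).κ (D.fam Φf) (D.isThetaEquivariant_fam_K K hK hΦ) (D.sitOf K hK).ι (D.sitOf K hK).hι f :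
        weightForms (S.P k).ΓU (D.sitOf K hK).κ (D.sitOf K hK).τ) :
      (V.latticeModel printFact_unitaryCompact_holds).G → (Fin 2 → ℂ)) = D.dist f Φf := by
  funext g
  refine WeightForms.eq_of_forall_dual_eq (R := ℂ) fun ℓ => ?_
  rw [ThetaKernelDatum.apply_thetaForm, apply_dist]
  rfl

include hK in
/-- **The distribution of a `K`-fixed `Φ_f` lies in the adèlic theta module of the slot SATURATED at `satLevelRegimeOf V hV K`**
(weight functions `𝓕 ∋ f`). -/
theorem dist_mem_adelicThetaSpanSat {Φf : FinSB (↥(maximalRealSubfield L)) (Fin 3)} (hΦ : ∀ g ∈ K, D.ωf (g, 1) Φf = Φf)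
    {𝓕 : Set C(↥(relNormOneIdeles (↥(maximalRealSubfield L)) L) ⧸ relNormOneRat (↥(maximalRealSubfield L)) L, ℂ)}
    {f : C(↥(relNormOneIdeles (↥(maximalRealSubfield L)) L) ⧸ relNormOneRat (↥(maximalRealSubfield L)) L, ℂ)} (hf : f ∈ 𝓕) :
    D.dist f Φf ∈ adelicThetaSpanSat (S.P k) S.ιinf (stabilizer U21 x₀).subtype
      (BallForms.isPullbackCocycle_cotangentCocycle.weightOf x₀) (satG hV K) 𝓕 := by
  rw [← D.coe_thetaForm_sitOf K hK hΦ f]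
  exact coe_mem_adelicThetaSpanSat (D.sitOf K hK) (D.sitOf_isSaturated K hK) (D.sitOf_isStrict K hK)
    ((S.P k).kernelDatum.thetaForm_mem_thetaForms _ _ _ _ _ _ (D.mem_famsK K hK hΦ) hf)

end Situation

/-! ### § 3. Holomorphic germs along `S.ιinf` -/

section Hol

/-- The archimedean slot at a finite vector: `Φ_∞ ↦ Φ_∞ ⊗ Φ_f`, read into the `Θ`-initial carrier of the slot. -/
def finSlotT (Φf : FinSB (↥(maximalRealSubfield L)) (Fin 3)) :
    𝓢((Fin 3 → mixedSpace (↥(maximalRealSubfield L))), ℂ) →ₗ[ℂ] (S.P k).weilDatum.ThetaTop :=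
  (piSchwartzBruhatEquiv (↥(maximalRealSubfield L)) (Fin 3)).toLinearMap ∘ₗ
    (TensorProduct.mk ℂ 𝓢((Fin 3 → mixedSpace (↥(maximalRealSubfield L))), ℂ) (FinSB (↥(maximalRealSubfield L)) (Fin 3))).flip Φf

omit D in
/-- (Ported verbatim from the HodgeCMPerL package; no docstring in the source.) -/
theorem finSlotT_apply (Φf : FinSB (↥(maximalRealSubfield L)) (Fin 3)) (Φinf : 𝓢((Fin 3 → mixedSpace (↥(maximalRealSubfield L))), ℂ)) :
    finSlotT (S := S) (k := k) Φf Φinf =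
      (S.P k).weilDatum.toThetaTop (piSchwartzBruhatEquiv (↥(maximalRealSubfield L)) (Fin 3) (Φinf ⊗ₜ[ℂ] Φf)) := rfl

omit D in
/-- **(W-cont) at every finite vector**: for an LF-continuous slot, `Φ_∞ ↦ Φ_∞ ⊗ Φ_f` is continuous into the `Θ`-initial carrier
(tree `continuous_toThetaTop_repWeilThetaDatum_tmul`, from the slot's own theta majorants). -/
theorem continuous_finSlotT (hLF : (S.P k).IsLFAction) (Φf : FinSB (↥(maximalRealSubfield L)) (Fin 3)) :
    Continuous (finSlotT (S := S) (k := k) Φf) :=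
  continuous_toThetaTop_repWeilThetaDatum_tmul (S.P k).ω.toHomUnits
    (((S.P k).ΓU.prod (relNormOneRat (↥(maximalRealSubfield L)) L) :
      Subgroup ((V.latticeModel printFact_unitaryCompact_holds).G × ↥(relNormOneIdeles (↥(maximalRealSubfield L)) L))) :
      Set ((V.latticeModel printFact_unitaryCompact_holds).G × ↥(relNormOneIdeles (↥(maximalRealSubfield L)) L)))
    (S.P k).majorants hLF Φf

/-- **The archimedean theta functional at the finite vector `Φ_f`**: `Φ_∞ ↦ Θ̃_{Φ_∞ ⊗ Φ_f}(f)(y)`, a CONTINUOUS linear functional on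
`𝓢((L⁺ ⊗ ℝ)³)` for an LF-continuous slot ((H1) at every finite vector). -/
def thetaArchCLMFin (hLF : (S.P k).IsLFAction) (Φf : FinSB (↥(maximalRealSubfield L)) (Fin 3))
    (f : C(↥(relNormOneIdeles (↥(maximalRealSubfield L)) L) ⧸ relNormOneRat (↥(maximalRealSubfield L)) L, ℂ))
    (y : (V.latticeModel printFact_unitaryCompact_holds).G) : 𝓢((Fin 3 → mixedSpace (↥(maximalRealSubfield L))), ℂ) →L[ℂ] ℂ :=
  ⟨(LinearMap.proj y : ((V.latticeModel printFact_unitaryCompact_holds).G → ℂ) →ₗ[ℂ] ℂ) ∘ₗ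
      (S.P k).kernelDatum.thetaLiftFunₗ (probHaarRelNormOneQuot (↥(maximalRealSubfield L)) L) (S.P k).kernelDatum_thetaLinear f ∘ₗ
        finSlotT (S := S) (k := k) Φf,
    ((continuous_eval_const (QuotientGroup.mk y⁻¹ : (V.latticeModel printFact_unitaryCompact_holds).G ⧸ (S.P k).ΓU)).comp
      ((S.P k).kernelDatum.continuous_thetaLift_left (probHaarRelNormOneQuot (↥(maximalRealSubfield L)) L) f)).comp
      (continuous_finSlotT hLF Φf)⟩

omit D in
/-- (Ported verbatim from the HodgeCMPerL package; no docstring in the source.) -/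
theorem thetaArchCLMFin_apply (hLF : (S.P k).IsLFAction) (Φf : FinSB (↥(maximalRealSubfield L)) (Fin 3))
    (f : C(↥(relNormOneIdeles (↥(maximalRealSubfield L)) L) ⧸ relNormOneRat (↥(maximalRealSubfield L)) L, ℂ))
    (y : (V.latticeModel printFact_unitaryCompact_holds).G) (Φinf : 𝓢((Fin 3 → mixedSpace (↥(maximalRealSubfield L))), ℂ)) :
    thetaArchCLMFin (S := S) (k := k) hLF Φf f y Φinf =
      (S.P k).kernelDatum.thetaLiftFun (probHaarRelNormOneQuot (↥(maximalRealSubfield L)) L)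
        ((S.P k).weilDatum.toThetaTop (piSchwartzBruhatEquiv (↥(maximalRealSubfield L)) (Fin 3) (Φinf ⊗ₜ[ℂ] Φf))) f y := rfl

/-- **KERNEL CHAIN**: the `ℓ`-component of `dist f Φ_f` at `y · ι_∞(g)` is the archimedean theta functional at `Φ_f` of `ωA(g) Φarch ℓ`. -/
theorem apply_dist_mul_ιinf (hLF : (S.P k).IsLFAction)
    (f : C(↥(relNormOneIdeles (↥(maximalRealSubfield L)) L) ⧸ relNormOneRat (↥(maximalRealSubfield L)) L, ℂ))
    (Φf : FinSB (↥(maximalRealSubfield L)) (Fin 3)) (y : (V.latticeModel printFact_unitaryCompact_holds).G) (g : U21)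
    (ℓ : Module.Dual ℂ (Fin 2 → ℂ)) :
    ℓ (D.dist f Φf (y * S.ιinf g)) = thetaArchCLMFin (S := S) (k := k) hLF Φf f y (D.ωA g (D.Φarch ℓ)) := by
  rw [apply_dist, ThetaKernelDatum.thetaLiftFun_mul_right, thetaArchCLMFin_apply]
  congr 1
  change (S.P k).ω (S.ιinf g, 1) (piSchwartzBruhatEquiv (↥(maximalRealSubfield L)) (Fin 3) (D.Φarch ℓ ⊗ₜ[ℂ] Φf)) =
    piSchwartzBruhatEquiv (↥(maximalRealSubfield L)) (Fin 3) (D.ωA g (D.Φarch ℓ) ⊗ₜ[ℂ] Φf)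
  rw [D.hA, adelicTensorEnd_apply_tmul, LinearMap.id_apply]

/-- **Holomorphic germs of the distribution** from (LF) continuity of the slot's operators, (AN) weak real-differentiability at `0` of
the boosts `b ↦ ωA (expP b) (Φarch ℓ)` through every continuous functional, and (REP′) the complex-linearity of their differentials —
E's binders `hLF` / `hpd` / `hk` read in carch's `archKTypeOf` currency (`isWeaklyPDiff_archKTypeOf`, `isWeaklyCR_of_isPMinusKilled`). -/
theorem isHolGerm_dist (hLF : (S.P k).IsLFAction)
    (hd : ∀ (T : 𝓢((Fin 3 → mixedSpace (↥(maximalRealSubfield L))), ℂ) →L[ℂ] ℂ) (ℓ : Module.Dual ℂ (Fin 2 → ℂ)),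
      DifferentiableAt ℝ (fun b => T (D.ωA (BallForms.expP b) (D.Φarch ℓ))) 0)
    (hCR : ∀ (T : 𝓢((Fin 3 → mixedSpace (↥(maximalRealSubfield L))), ℂ) →L[ℂ] ℂ) (ℓ : Module.Dual ℂ (Fin 2 → ℂ)) (v : Fin 2 → ℂ),
      fderiv ℝ (fun b => T (D.ωA (BallForms.expP b) (D.Φarch ℓ))) 0 (Complex.I • v) =
        Complex.I • fderiv ℝ (fun b => T (D.ωA (BallForms.expP b) (D.Φarch ℓ))) 0 v)
    (f : C(↥(relNormOneIdeles (↥(maximalRealSubfield L)) L) ⧸ relNormOneRat (↥(maximalRealSubfield L)) L, ℂ))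
    (Φf : FinSB (↥(maximalRealSubfield L)) (Fin 3)) : IsHolGerm S.ιinf (D.dist f Φf) := by
  have hcomp : ∀ (y : (V.latticeModel printFact_unitaryCompact_holds).G) (j : Fin 2),
      (fun b => germAt S.ιinf (D.dist f Φf) y b j) =
        fun b => thetaArchCLMFin (S := S) (k := k) hLF Φf f y (D.ωA (BallForms.expP b) (D.Φarch (LinearMap.proj j))) := by
    intro y j
    funext b
    exact D.apply_dist_mul_ιinf hLF f Φf y (BallForms.expP b) (LinearMap.proj j)
  have key : ∀ y : (V.latticeModel printFact_unitaryCompact_holds).G,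
      DifferentiableAt ℝ (germAt S.ιinf (D.dist f Φf) y) 0 ∧
        ∀ v : Fin 2 → ℂ, fderiv ℝ (germAt S.ιinf (D.dist f Φf) y) 0 (Complex.I • v) =
          Complex.I • fderiv ℝ (germAt S.ιinf (D.dist f Φf) y) 0 v := fun y =>
    ThetaHolAssembly.differentiableAt_and_fderiv_I_smul_pi (Fv := germAt S.ιinf (D.dist f Φf) y)
      (fun j => by rw [hcomp y j]; exact hd _ _) (fun j v => by rw [hcomp y j]; exact hCR _ _ v)
  exact ⟨fun y => (key y).1, fun y v => (key y).2 v⟩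

end Hol

/-! ### § 4. The distribution into the saturated hol-germ theta module of the slot, all levels -/

section HolSatU

variable (hGfin : ∀ K : Subgroup ↥V.adelicFin, satG hV K ≤ S.Gfin) (hLF : (S.P k).IsLFAction)
  (hd : ∀ (T : 𝓢((Fin 3 → mixedSpace (↥(maximalRealSubfield L))), ℂ) →L[ℂ] ℂ) (ℓ : Module.Dual ℂ (Fin 2 → ℂ)),
    DifferentiableAt ℝ (fun b => T (D.ωA (BallForms.expP b) (D.Φarch ℓ))) 0)
  (hCR : ∀ (T : 𝓢((Fin 3 → mixedSpace (↥(maximalRealSubfield L))), ℂ) →L[ℂ] ℂ) (ℓ : Module.Dual ℂ (Fin 2 → ℂ)) (v : Fin 2 → ℂ),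
    fderiv ℝ (fun b => T (D.ωA (BallForms.expP b) (D.Φarch ℓ))) 0 (Complex.I • v) =
      Complex.I • fderiv ℝ (fun b => T (D.ωA (BallForms.expP b) (D.Φarch ℓ))) 0 v)
  {𝓕 : Set C(↥(relNormOneIdeles (↥(maximalRealSubfield L)) L) ⧸ relNormOneRat (↥(maximalRealSubfield L)) L, ℂ)}
  {f : C(↥(relNormOneIdeles (↥(maximalRealSubfield L)) L) ⧸ relNormOneRat (↥(maximalRealSubfield L)) L, ℂ)}

include hGfin hLF hd hCR in
/-- **`dist f Φ_f ∈ holSat Γ`** at any tower level `Γ` whose compact open fixes `Φ_f`. -/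
theorem dist_mem_holSat (Γ : Level V) {Φf : FinSB (↥(maximalRealSubfield L)) (Fin 3)} (hΦ : ∀ g ∈ Γ.K, D.ωf (g, 1) Φf = Φf)
    (hf : f ∈ 𝓕) : D.dist f Φf ∈ S.holSat hV k Γ 𝓕 :=
  ⟨D.dist_mem_adelicThetaSpanSat Γ.K (hGfin Γ.K) hΦ hf, D.isHolGerm_dist hLF hd hCR f Φf⟩

/-- Smoothness gives a tower level (below `K_f(3)`) whose compact open fixes `Φ_f`. -/
theorem exists_tlvl_fix (Φf : FinSB (↥(maximalRealSubfield L)) (Fin 3)) : ∃ i : TLvl V, ∀ g ∈ i.1.K, D.ωf (g, 1) Φf = Φf := by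
  obtain ⟨K₀, hK₀, hfix⟩ := D.smooth Φf
  exact ⟨⟨Level.capThree K₀ hK₀, Level.belowConjThree_capThree K₀ hK₀⟩, fun g hg => hfix g (Level.capThree_K_le K₀ hK₀ hg)⟩


-- port_pkg: scope closed for this part
end HolSatU
end ThetaDistDatum
end ThetaAdelicSide
end Model
end HodgeCM
end
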